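/-
Copyright (c) 2026 the pub-hodgecm-mathlib formalisation cell (harness21).  Prover seat hodgecm-mathlib-K2E3-p17 (g4), Track B «K2-LIT» ∕ h413
(stmt-HodgeConjecture-24833), ‹S› ROAD J ∕ R3 «RANK-ONE MASS», (r)-class of letter ‹J3› v2 (leaf (J3r), ramified odd), brick R3g-ram «BLOCK MODEL OF THE COMPACT
SHEET AT A RAMIFIED ODD PLACE» (dealer K2E3-plan (g2) DEAL (D22a) 02:16Z; recipe K2E3-p03 (g2) 02:08:41Z; twin of ★ R3g K2E4-p07 (g3) p856521).  2026-09-04.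
-/
import Summits.HodgeConjecture.HodgeConjecture.Theorems.K2E3CompactSheetBlockModel      -- ★ R3g p856521 (K2E4-p07): `blocks_of_twistGram_eq_finSum`, `exists_gl_one_formCongr_eq`; brings ★ kit p856451 + the place-free local algebra
import Literature.NumberTheory.LocalFields.RamifiedPlaceGlobalNonNormUnit               -- ★ p856712 (K2E3-p03): `exists_global_unit_not_norm_of_ramified` (a global unit of non-square residue at `w`)
import Literature.NumberTheory.Automorphic.AnisotropicUnitaryGroupCompactOfPlace         -- ★ `conjLocal_apply_eq_of_smul_eq` (`(c ⊗ 1) y` read at the unique `w ∣ v`)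
import HarnessLib

/-!
# ‹S› road J ∕ R3 — R3g-ram «BLOCK MODEL OF THE COMPACT SHEET AT A RAMIFIED ODD PLACE»: the second class `ε′` of the κ-block sits, through a local form congruence, as a
# BLOCK-SCALAR point of `U(⟨1, −ξ⟩ ⊕ᶠ ⟨c_b⟩)(L⁺_v)` with GLOBAL blocks, `ξ ∈ L⁺` a UNIT which is NOT A NORM at `w` (Rogawski 1990 §3.8 Prop. 3.8.1 (a),(d) p. 30; §8.1 p. 116)

Cell `pub/hodgecm-mathlib`, Track B «K2-LIT», crux H413 = `stmt-HodgeConjecture-24833`; ‹S› ROAD J, letter ‹J3› (v2) `sig_K2E3CompatibleMeasureEPIdentityRankOne`, residue class (J3r)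
`U3bCentralGerms.sig_K2E3CompatibleMeasureEPIdentityRankOneRamifiedOdd` (PART B ED. 8 :420), payer road R3 «RANK-ONE MASS» (owner K2E3-p15; (r)-class K2E3-p03 (g2) → this seat).
THEOREMS ONLY (no definition, no instance, no notation, no `sorry`); `--supports stmt-HodgeConjecture-24833 --as helper`.

THIS FILE is the RAMIFIED (`e(w|v) ≠ 1`), ODD (`2 ∉ v`) twin of ★ R3g `K2E3CompactSheetBlockModel.exists_blockModel_compactSheet` (K2E4-p07 (g3)).  ★ R3g uses `IsUnramifiedIn` in exactly
two places: the global uniformizer `ξ = ϖ_v` (`|ξ|_w = exp(−1)`) and the fact that it is NOT a norm (odd order).  At a RAMIFIED place `ϖ_v` MAY be a norm; the non-trivial class of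
`L⁺_v^× ∕ N(L_w^×)` (index two) is represented instead by a UNIT of NON-SQUARE residue [Serre1979, V §3 Cor. 2], and ★ p856712 `exists_global_unit_not_norm_of_ramified` (K2E3-p03 (g2))
supplies a GLOBAL such `ξ ∈ L⁺`.  Everything else in ★ R3g (the bad block is anisotropic ★ `not_exists_neg_det_badBlock_eq_norm`, norm index two ★ `exists_norm_mul_of_not_exists_norm`,
Jacobowitz rank 2 ★ `exists_formCongr_eq_of_det_eq_mul_norm`, the congruence kit) is place-free, and the proof below is R3g's, token for token, with the two replacements.

* §1 **`exists_global_unit_not_norm_localRing`** — the kit lemma read in `L ⊗ L⁺_v = ∏_{w ∣ v} L_w`: a global `ξ ∈ L⁺` with `|ξ|_w = 1`, `|σ_w u·u − ξ|_w = 1` for all units `u` (the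
  binders `hξ1 hξN` of ★ S4 (r) `K2E3CompactSheetMassRamified` and of ★ `anisoPlaneUnit_integralLevel_top_and_compactSpace`), `ι ξ` a `(c ⊗ 1)`-fixed unit, and `ι ξ ≠ σ(z)·z` for every unit
  `z` of `L ⊗ L⁺_v` (the twin of ★ kit `exists_global_uniformizer` ∧ ★ `not_exists_uniformizer_eq_norm`).
* §2 **`exists_blockModel_compactSheet_ramified`** — from the ‹J3 v2› frame (central point `ε_H = (a·1₂, u)`, dock `θ` read in `GL₃` by `y`, swap `W`, dock frame `(G₁, G₂)`, bad frame
  `(P′, G₁′, G₂′)` with `det G₁′ ∉ det G₁ · N`, second class `ε′` framed by `P′`) at a ramified odd non-split `v`: GLOBAL `ξ, c_b ∈ L⁺` with `|ξ|_w = 1`, `hξN`, `c_b ∈ {1, ξ}`, a local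
  change of basis `T ∈ GL₃(L ⊗ L⁺_v)` with `ᵗ(σT)·H′_v·T = (⟨1, −ξ⟩ ⊕ᶠ ⟨c_b⟩)_v` (scalar `1`) and a point `x ∈ U(⟨1,−ξ⟩ ⊕ᶠ ⟨c_b⟩)(L⁺_v)` with matrix `a·1₂ ⊕ᶠ u·1₁`, `a − u` a unit,
  `φ_T x = ε′` — EXACTLY the input binders `(ξ cb hξc hξ1 hξN hcb T hT x hau hx y hy)` of ★ S4 (r) p856688 `toReal_finTamagawaPartner_univ_eq_of_anisoUnitBlockModel_ramified` (`4(q+1)∕q³`).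

THE PROOF (all inputs ★).  (1) The bad block is ANISOTROPIC: `−det G₁′ ∉ N`.  (2) `ϖ := ι(ξ)` is a `σ`-fixed unit of `L ⊗ L⁺_v` which is NOT a norm (§1), so by index two
`−det G₁′ = N(z)·ϖ`, i.e. `det ⟨1,−ξ⟩_v = −ϖ = det G₁′ · N(z⁻¹)`; Jacobowitz gives `S₁` with `ᵗσ(S₁) G₁′ S₁ = ⟨1, −ξ⟩_v`.  (3) The line: `g = (G₂′)₀₀` is a `σ`-fixed unit; either
`g = N(z)` (`c_b := 1`) or `g = N(z)·ϖ` (index two; `c_b := ξ`); `S₂ := (z⁻¹)`.  (4) `T := P′·(S₁ ⊕ᶠ S₂)`, `x := φ_T⁻¹ ε′`, matrix `(S₁⊕S₂)⁻¹(a·1 ⊕ᶠ u)(S₁⊕S₂) = a·1 ⊕ᶠ u`.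

HONEST LABEL: HC_CM is proved only modulo the 7 printed citations (2 remaining named inputs: hLiu418 = stmt-HodgeConjecture-24832, h413 = stmt-HodgeConjecture-24833) until rung 0
closes; this file is a count-neutral helper (local algebra + local class field theory of a tamely ramified quadratic extension); (J3r) is NOT proved here.

## References
* [Rogawski1990] J. D. Rogawski, *Automorphic Representations of Unitary Groups in Three Variables*, Ann. of Math. Stud. 123 (1990), §3.8 Prop. 3.8.1 (a),(d) p. 30; §8.1 p. 116.
* [Jacobowitz1962] R. Jacobowitz, *Hermitian forms over local fields*, Amer. J. Math. 84 (1962), §3 Thm. 3.1 (classification by determinant class), §§7–8 (ramified normal forms).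
* [Serre1979] J.-P. Serre, *Local Fields*, GTM 67 (1979), Ch. V §3 Prop. 5, Cor. 2 (norm group of a tamely ramified quadratic extension: index two, residue character).
* [Omeara1963] O. T. O'Meara, *Introduction to Quadratic Forms* (1963), §63B Prop. 63:13 (local norm index two).
* [PlatonovRapinchuk1994] V. Platonov, A. Rapinchuk, *Algebraic Groups and Number Theory* (1994), §2.3, §5.1.
-/

set_option autoImplicit false
set_option linter.dupNamespace false

noncomputable section

open NumberField IsDedekindDomain Matrix
open Literature.NumberTheory.Automorphic Literature.NumberTheory.Automorphic.UnitaryGroup Literature.NumberTheory.GaloisRepresentations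
open Literature.NumberTheory.Rogawski1990 Literature.NumberTheory.Weil1982.UnitaryFinTopForm
open Literature.NumberTheory.LocalFields.RamifiedPlaceUnitNorms
open Summit.HodgeConjecture.HodgeConjecture.Cruxes.H413.K2E3CompactSheetBlockModelKit
open Summit.HodgeConjecture.HodgeConjecture.Cruxes.H413.K2E3CompactSheetBlockModel
open scoped MatrixGroups

namespace Summit.HodgeConjecture.HodgeConjecture.Cruxes.H413.K2E3CompactSheetBlockModelRamified

variable (L : Type) [Field L] [NumberField L] [IsCMField L] (H' : Matrix (Fin 3) (Fin 3) L)
  (hherm : (H'.map (cmConjRingHom L))ᵀ = H') (hanis : ∀ x : Fin 3 → L, Literature.AlgebraicGeometry.ShimuraVarieties.hermForm (cmConjRingHom L) H' x x = 0 → x = 0)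
  (v : HeightOneSpectrum (𝓞 ↥(maximalRealSubfield L))) (w : PlacesOver L v) (hw : IsCMField.complexConj L • w.1 = w.1)
  (he : v.asIdeal.ramificationIdx' w.1.asIdeal ≠ 1) (h2 : (2 : 𝓞 ↥(maximalRealSubfield L)) ∉ v.asIdeal)

/-! ## §1 The global non-norm unit `ξ ∈ L⁺` read in `L ⊗ L⁺_v` -/

section NonNormUnit

include hw he h2 in
/-- **A GLOBAL NON-NORM UNIT AT A TAMELY RAMIFIED PLACE, READ IN `L ⊗ L⁺_v = ∏_{w ∣ v} L_w`.**  For `w ∣ v` ramified (`e(w|v) ≠ 1`), `2 ∉ v`, `c • w = w`: some `ξ ∈ L⁺ ⊂ L`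
(`complexConj ξ = ξ`) has `|ξ|_w = 1`, `|σ_w u · u − ξ|_w = 1` for every unit `u ∈ L_w` (non-square residue), its image `ι ξ ∈ L ⊗ L⁺_v` is a `(c ⊗ 1)`-fixed unit, and `ι ξ` is
NOT of the form `σ(z)·z` with `z` a unit of `L ⊗ L⁺_v` (read at the unique place `w` above `v`: `(σ z)_w = σ_w(z_w)`, ★ `conjLocal_apply_eq_of_smul_eq`).  The ramified replacement of
★ kit `exists_global_uniformizer` + ★ `not_exists_uniformizer_eq_norm`, over ★ `exists_global_unit_not_norm_of_ramified`. [cite: Serre1979, Ch. V §3 Prop. 5, Cor. 2]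
[cite: Omeara1963, §63B Prop. 63:13] -/
theorem exists_global_unit_not_norm_localRing :
    ∃ ξ : L, IsCMField.complexConj L ξ = ξ ∧
      Valued.v (algebraMap L (w.1.adicCompletion L) ξ) = 1 ∧
      (∀ u : w.1.adicCompletion L, Valued.v u = 1 →
        Valued.v (galAdicCompletionMap (L := L) (IsCMField.complexConj L) hw u * u - algebraMap L (w.1.adicCompletion L) ξ) = 1) ∧
      IsUnit (algebraMap L (LocalRing L v) ξ) ∧
      conjLocal L (IsCMField.complexConj L) v (algebraMap L (LocalRing L v) ξ) = algebraMap L (LocalRing L v) ξ ∧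
      ¬ ∃ z : LocalRing L v, IsUnit z ∧ algebraMap L (LocalRing L v) ξ = conjLocal L (IsCMField.complexConj L) v z * z := by
  haveI : Algebra.IsQuadraticExtension ↥(maximalRealSubfield L) L := IsCMField.isQuadraticExtension L
  obtain ⟨ξ, hξc, hξ1, -, hξN, hξnn⟩ := exists_global_unit_not_norm_of_ramified L v w hw he h2
  have hξ0 : ξ ≠ 0 := by
    intro h0
    rw [h0, map_zero, map_zero] at hξ1
    exact zero_ne_one hξ1
  refine ⟨ξ, hξc, hξ1, hξN, (isUnit_iff_ne_zero.2 hξ0).map _, by rw [Literature.NumberTheory.Rogawski1990.conjLocal_algebraMap, hξc], ?_⟩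
  rintro ⟨z, -, hz⟩
  -- read `ι ξ = σ(z)·z` at `w`: `ξ = σ_w(z_w) · z_w`
  have h := congrFun hz w
  rw [Pi.mul_apply, conjLocal_apply_eq_of_smul_eq (IsCMField.complexConj L) (IsCMField.complexConj_ne_one L) v w hw z] at h
  exact hξnn ⟨z w, by rw [mul_comm]; exact h.symm⟩

end NonNormUnit

/-! ## §2 The block model of the compact sheet at a ramified odd place -/

include hherm hanis hw he h2 in
set_option maxHeartbeats 1600000 in
/-- **R3g-ram «BLOCK MODEL OF THE COMPACT SHEET AT A RAMIFIED ODD PLACE».**  See the module docstring: from the ‹J3 v2› frame (central point, dock `θ` with its `GL₃`-reading `y`, swap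
`W`, dock frame `(G₁, G₂)`, bad frame `(P′, G₁′, G₂′)` with `det G₁′ ∉ det G₁ · N`, second class `ε′` framed by `P′`) at a non-split `v` RAMIFIED in `L` (`e(w|v) ≠ 1`) with `2 ∉ v`:
GLOBAL `ξ, c_b ∈ L⁺` with `|ξ|_w = 1`, `|σ_w u·u − ξ|_w = 1` for all units `u` (a unit which is not a norm at `w`), `c_b ∈ {1, ξ}`, a congruence `T` with
`ᵗ(σT) H′_v T = (!![1,0;0,−ξ] ⊕ᶠ !![c_b])_v`, and the block-scalar preimage `x = φ_T⁻¹ ε′` — the hypotheses `(ξ cb hξc hξ1 hξN hcb T hT x hau hx y hy)` of ★ S4 (r)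
`toReal_finTamagawaPartner_univ_eq_of_anisoUnitBlockModel_ramified`.  Twin of ★ R3g `exists_blockModel_compactSheet` (unramified: `ξ = ϖ_v`). [cite: Rogawski1990, §3.8 Prop. 3.8.1 (a),(d) p. 30; §8.1 p. 116]
[cite: Jacobowitz1962, §3 Thm. 3.1; §§7–8] [cite: Serre1979, Ch. V §3 Cor. 2] [cite: Omeara1963, §63B Prop. 63:13] -/
theorem exists_blockModel_compactSheet_ramified
    (εH : ((cmDatum L 2 (Matrix.of fun i j : Fin 2 => if i.val + j.val + 1 = 2 then (1 : L) else 0)).Local v ×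
      (cmDatum L 1 (Matrix.of fun i j : Fin 1 => if i.val + j.val + 1 = 1 then (1 : L) else 0)).Local v)) (a : LocalRing L v)
    (hu : (εH.2.val.val : Matrix (Fin 1) (Fin 1) (LocalRing L v)) 0 0 ≠ a)
    {ε : (cmDatum L 3 H').Local v} {y : GL (Fin 3) (LocalRing L v)}
    (θ : ((cmDatum L 2 (Matrix.of fun i j : Fin 2 => if i.val + j.val + 1 = 2 then (1 : L) else 0)).Local v ×
      (cmDatum L 1 (Matrix.of fun i j : Fin 1 => if i.val + j.val + 1 = 1 then (1 : L) else 0)).Local v) ≃ₜ* ↥(Subgroup.centralizer ({ε} : Set ((cmDatum L 3 H').Local v))))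
    (hθ : ∀ z : ((cmDatum L 2 (Matrix.of fun i j : Fin 2 => if i.val + j.val + 1 = 2 then (1 : L) else 0)).Local v ×
      (cmDatum L 1 (Matrix.of fun i j : Fin 1 => if i.val + j.val + 1 = 1 then (1 : L) else 0)).Local v),
      (((θ z).1).val : GL (Fin 3) (LocalRing L v)) = y * ((endoEmbLocal L v z).val : GL (Fin 3) (LocalRing L v)) * y⁻¹)
    {W : GL (Fin 3) (LocalRing L v)} (hW : W.val = !![(1 : LocalRing L v), 0, 0; 0, 0, 1; 0, 1, 0])
    {G₁ G₁' : Matrix (Fin 2) (Fin 2) (LocalRing L v)} {G₂ G₂' : Matrix (Fin 1) (Fin 1) (LocalRing L v)} (P' : GL (Fin (2 + 1)) (LocalRing L v))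
    (hPW : twistGram (conjLocal L (IsCMField.complexConj L) v) ((adelicForm L 3 H').map (adeleToLocal L v)) (y * W).val = finSum 2 1 G₁ G₂)
    (hP' : twistGram (conjLocal L (IsCMField.complexConj L) v) ((adelicForm L 3 H').map (adeleToLocal L v)) P'.val = finSum 2 1 G₁' G₂')
    (hnn : ¬ ∃ z : LocalRing L v, IsUnit z ∧ G₁'.det = G₁.det * (conjLocal L (IsCMField.complexConj L) v z * z))
    (ε' : (cmDatum L 3 H').Local v)
    (hε' : (ε'.val.val : Matrix (Fin 3) (Fin 3) (LocalRing L v)) * P'.val =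
      P'.val * finSum 2 1 (a • (1 : Matrix (Fin 2) (Fin 2) (LocalRing L v))) (εH.2.val.val : Matrix (Fin 1) (Fin 1) (LocalRing L v))) :
    ∃ (ξ cb : L), IsCMField.complexConj L ξ = ξ ∧ IsCMField.complexConj L cb = cb ∧
      Valued.v (algebraMap L (w.1.adicCompletion L) ξ) = 1 ∧
      (∀ u : w.1.adicCompletion L, Valued.v u = 1 →
        Valued.v (galAdicCompletionMap (L := L) (IsCMField.complexConj L) hw u * u - algebraMap L (w.1.adicCompletion L) ξ) = 1) ∧
      cb ≠ 0 ∧ (cb = 1 ∨ cb = ξ) ∧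
      ∃ (T : GL (Fin (2 + 1)) (LocalRing L v))
        (hT : formCongr (conjLocal L (IsCMField.complexConj L) v) T (H'.map (algebraMap L (LocalRing L v))) =
          (1 : LocalRing L v) • (finSum 2 1 !![(1 : L), 0; 0, -ξ] !![cb]).map (algebraMap L (LocalRing L v)))
        (x : (cmDatum L (2 + 1) (finSum 2 1 !![(1 : L), 0; 0, -ξ] !![cb])).Local v),
        IsUnit (a - (εH.2.val.val : Matrix (Fin 1) (Fin 1) (LocalRing L v)) 0 0) ∧
        mat L (2 + 1) (finSum 2 1 !![(1 : L), 0; 0, -ξ] !![cb]) v x =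
          finSum 2 1 (a • (1 : Matrix (Fin 2) (Fin 2) (LocalRing L v))) (((εH.2.val.val : Matrix (Fin 1) (Fin 1) (LocalRing L v)) 0 0) • (1 : Matrix (Fin 1) (Fin 1) (LocalRing L v))) ∧
        cmDatumLocalCongr L v T isUnit_one hT x = ε' := by
  classical
  -- (0) the field `L ⊗ L⁺_v = L_w`, its involution `σ`, an anti-fixed `δ`
  set σ := conjLocal L (IsCMField.complexConj L) v with hσdef
  have hF : IsField (LocalRing L v) := LocalRing.isField_of_smul_eq (IsCMField.complexConj L) (IsCMField.complexConj_ne_one L) w hw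
  obtain ⟨x₀, hx₀⟩ := Literature.NumberTheory.NumberFields.IsCMField.exists_complexConj_ne L
  set δ : L := x₀ - IsCMField.complexConj L x₀ with hδdef
  have hcδ : IsCMField.complexConj L δ = -δ := by rw [hδdef, map_sub, IsCMField.complexConj_apply_apply, neg_sub]
  have hδ : δ ≠ 0 := fun h => hx₀ (sub_eq_zero.1 h).symm
  have hσσ : ∀ s, σ (σ s) = s := Liu2021.LemD1OfPlace.conjLocal_conjLocal_apply L v (IsCMField.complexConj L) hcδ hδ
  have hdet' : H'.det ≠ 0 := Godement.det_ne_zero_of_anisotropic L H' hanis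
  have hHv : (((adelicForm L 3 H').map (adeleToLocal L v)).map σ)ᵀ = (adelicForm L 3 H').map (adeleToLocal L v) :=
    map_conjLocal_transpose_localForm L 3 H' v hherm
  have hHvd : IsUnit ((adelicForm L 3 H').map (adeleToLocal L v)).det := UnitaryGroup.isUnit_det_localForm L 3 H' v hdet'
  have hunit_of_ne : ∀ {t : LocalRing L v}, t ≠ 0 → IsUnit t := fun {t} ht => by
    obtain ⟨s, hs⟩ := hF.mul_inv_cancel ht
    exact isUnit_iff_exists_inv.2 ⟨s, hs⟩
  -- (1) blocks of the bad frame
  obtain ⟨hG₁'h, hgσ, hG₁'d, hgu⟩ := blocks_of_twistGram_eq_finSum σ hσσ hHv hHvd P' hP'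
  -- (2) the bad block is anisotropic, the global unit `ξ` is not a norm, index two
  have hbad := not_exists_neg_det_badBlock_eq_norm L H' v w hw hherm hdet' θ hθ hW hPW hnn
  obtain ⟨ξ, hξc, hξ1, hξN, hϖu, hϖσ', hϖnn⟩ := exists_global_unit_not_norm_localRing L v w hw he h2
  set ϖ : LocalRing L v := algebraMap L (LocalRing L v) ξ with hϖdef
  have hϖσ : σ ϖ = ϖ := hϖσ'
  have hξ0 : ξ ≠ 0 := by
    intro h0
    rw [h0, map_zero, map_zero] at hξ1
    exact zero_ne_one hξ1
  have hdetσ : σ (-G₁'.det) = -G₁'.det := by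
    rw [map_neg]
    congr 1
    have h := congrArg Matrix.det hG₁'h
    rwa [Matrix.det_transpose, ← RingHom.mapMatrix_apply, ← RingHom.map_det] at h
  obtain ⟨z₁, hz₁u, hz₁⟩ := exists_norm_mul_of_not_exists_norm L v (IsCMField.complexConj L) hcδ hδ w hw hϖσ hϖu hdetσ hG₁'d.neg
    (fun ⟨z, hz, h⟩ => hϖnn ⟨z, hz, h⟩) (fun ⟨z, hz, h⟩ => hbad ⟨z, hz, h⟩)
  -- (3) the plane congruence `ᵗσ(S₁) G₁′ S₁ = ⟨1, −ξ⟩_v`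
  have hHa : (!![(1 : L), 0; 0, -ξ]).map (algebraMap L (LocalRing L v)) = !![(1 : LocalRing L v), 0; 0, -ϖ] := by
    rw [hϖdef]
    ext i j; fin_cases i <;> fin_cases j <;> simp
  have hHah : ((!![(1 : LocalRing L v), 0; 0, -ϖ]).map σ)ᵀ = !![(1 : LocalRing L v), 0; 0, -ϖ] := by
    ext i j; fin_cases i <;> fin_cases j <;> simp [hϖσ]
  have hHad : IsUnit (!![(1 : LocalRing L v), 0; 0, -ϖ]).det := by
    rw [Matrix.det_fin_two_of]; simpa using hϖu.neg
  have hdet : ∃ z : LocalRing L v, IsUnit z ∧ (!![(1 : LocalRing L v), 0; 0, -ϖ]).det = G₁'.det * (σ z * z) := by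
    refine ⟨↑(hz₁u.unit⁻¹), (hz₁u.unit⁻¹).isUnit, ?_⟩
    rw [Matrix.det_fin_two_of]
    have h3 : z₁ * ↑(hz₁u.unit⁻¹) = 1 := hz₁u.mul_val_inv
    have h4 : σ z₁ * σ ↑(hz₁u.unit⁻¹) = 1 := by rw [← map_mul, h3, map_one]
    -- `−ϖ = det G₁′ · N(z₁⁻¹)` from `−det G₁′ = N(z₁) ϖ`
    have key : G₁'.det = -(σ z₁ * z₁ * ϖ) := by rw [← hz₁, neg_neg]
    rw [key]
    have e : -(σ z₁ * z₁ * ϖ) * (σ ↑(hz₁u.unit⁻¹) * ↑(hz₁u.unit⁻¹)) = -ϖ * ((σ z₁ * σ ↑(hz₁u.unit⁻¹)) * (z₁ * ↑(hz₁u.unit⁻¹))) := by ring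
    rw [e, h3, h4]; simp
  obtain ⟨S₁, hS₁⟩ := exists_formCongr_eq_of_det_eq_mul_norm L v (IsCMField.complexConj L) hcδ hδ w hw hG₁'h hHah hG₁'d hHad hdet
  -- (4) the line: `g = (G₂′)₀₀`, `c_b ∈ {1, ξ}`
  set g : LocalRing L v := G₂' 0 0 with hgdef
  obtain ⟨s, cb, hsu, hcbc, hcb0, hcb1ξ, hcbloc⟩ : ∃ (s : LocalRing L v) (cb : L), IsUnit s ∧ IsCMField.complexConj L cb = cb ∧ cb ≠ 0 ∧ (cb = 1 ∨ cb = ξ) ∧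
      algebraMap L (LocalRing L v) cb = σ s * g * s := by
    by_cases hg : ∃ z : LocalRing L v, IsUnit z ∧ g = σ z * z
    · obtain ⟨z, hzu, hz⟩ := hg
      refine ⟨↑(hzu.unit⁻¹), 1, (hzu.unit⁻¹).isUnit, map_one _, one_ne_zero, Or.inl rfl, ?_⟩
      have h3 : z * ↑(hzu.unit⁻¹) = 1 := hzu.mul_val_inv
      have h4 : σ z * σ ↑(hzu.unit⁻¹) = 1 := by rw [← map_mul, h3, map_one]
      rw [map_one, hz]
      have e : σ ↑(hzu.unit⁻¹) * (σ z * z) * ↑(hzu.unit⁻¹) = (σ z * σ ↑(hzu.unit⁻¹)) * (z * ↑(hzu.unit⁻¹)) := by ring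
      rw [e, h3, h4, mul_one]
    · obtain ⟨z, hzu, hz⟩ := exists_norm_mul_of_not_exists_norm L v (IsCMField.complexConj L) hcδ hδ w hw hϖσ hϖu hgσ hgu
        (fun ⟨z, hz, h⟩ => hϖnn ⟨z, hz, h⟩) hg
      refine ⟨↑(hzu.unit⁻¹), ξ, (hzu.unit⁻¹).isUnit, hξc, hξ0, Or.inr rfl, ?_⟩
      have h3 : z * ↑(hzu.unit⁻¹) = 1 := hzu.mul_val_inv
      have h4 : σ z * σ ↑(hzu.unit⁻¹) = 1 := by rw [← map_mul, h3, map_one]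
      rw [← hϖdef, hz]
      have e : σ ↑(hzu.unit⁻¹) * (σ z * z * ϖ) * ↑(hzu.unit⁻¹) = ϖ * ((σ z * σ ↑(hzu.unit⁻¹)) * (z * ↑(hzu.unit⁻¹))) := by ring
      rw [e, h3, h4, mul_one, mul_one]
  obtain ⟨S₂, hS₂v, hS₂⟩ := exists_gl_one_formCongr_eq σ hsu G₂'
  have hHb : (!![cb]).map (algebraMap L (LocalRing L v)) = formCongr σ S₂ G₂' := by
    rw [hS₂, ← hcbloc]
    ext i j; fin_cases i; fin_cases j; simp
  -- (5) the congruence `T = P′ · (S₁ ⊕ᶠ S₂)`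
  obtain ⟨S, hS, hSi⟩ := exists_gl_val_eq_finSum S₁ S₂
  have hP'f : formCongr σ P' (H'.map (algebraMap L (LocalRing L v))) = finSum 2 1 G₁' G₂' := by
    rw [← Literature.NumberTheory.Rogawski1990.adelicForm_map_adeleToLocal L v H']; exact hP'
  have hT : formCongr σ (P' * S) (H'.map (algebraMap L (LocalRing L v))) =
      (1 : LocalRing L v) • (finSum 2 1 !![(1 : L), 0; 0, -ξ] !![cb]).map (algebraMap L (LocalRing L v)) := by
    rw [one_smul, finSum_map, formCongr_mul_of_finSum σ _ P' S S₁ S₂ hP'f hS, hS₁, hHa, hHb]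
  -- (6) the block-scalar preimage `x = φ_T⁻¹ ε′`
  set φ := cmDatumLocalCongr L v (P' * S) isUnit_one hT with hφdef
  refine ⟨ξ, cb, hξc, hcbc, hξ1, hξN, hcb0, hcb1ξ, P' * S, hT, φ.symm ε', hunit_of_ne (sub_ne_zero.2 hu.symm), ?_, φ.apply_symm_apply ε'⟩
  -- the matrix of `x`: `(P′S)·mat x·(P′S)⁻¹ = ε′`
  have hconj : (P' * S) * (φ.symm ε').val * (P' * S)⁻¹ = ε'.val := by
    rw [← coe_cmDatumLocalCongr_apply L v (P' * S) isUnit_one hT (φ.symm ε')]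
    exact congrArg Subtype.val (φ.apply_symm_apply ε')
  have hx1 : (φ.symm ε').val = S⁻¹ * (P'⁻¹ * ε'.val * P') * S := by
    rw [← hconj]; group
  have hPε : (P'⁻¹).val * (ε'.val.val : Matrix (Fin 3) (Fin 3) (LocalRing L v)) * P'.val =
      finSum 2 1 (a • (1 : Matrix (Fin 2) (Fin 2) (LocalRing L v))) (εH.2.val.val : Matrix (Fin 1) (Fin 1) (LocalRing L v)) := by
    rw [Matrix.mul_assoc, hε', ← Matrix.mul_assoc, ← Units.val_mul, inv_mul_cancel, Units.val_one, Matrix.one_mul]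
  have hx2 : ((P'⁻¹ * ε'.val * P' : GL (Fin (2 + 1)) (LocalRing L v)).val : Matrix (Fin (2 + 1)) (Fin (2 + 1)) (LocalRing L v)) =
      finSum 2 1 (a • (1 : Matrix (Fin 2) (Fin 2) (LocalRing L v))) (εH.2.val.val : Matrix (Fin 1) (Fin 1) (LocalRing L v)) := by
    rw [Units.val_mul, Units.val_mul]; exact hPε
  rw [mat_def, hx1, Units.val_mul, Units.val_mul, hx2, finSum_inv_mul_scalar_mul S S₁ S₂ hS hSi, ← fin_one_eq_smul_one]

end Summit.HodgeConjecture.HodgeConjecture.Cruxes.H413.K2E3CompactSheetBlockModelRamified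

end
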